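import Mathlib
import HarnessLib
import Summits.HubbardSuperconductivity.HubbardSuperconductivity.Theorems.ChiralWindowDefsEx
import Summits.HubbardSuperconductivity.HubbardSuperconductivity.Theorems.ChiralWindowCwKLChiralWindowCertTrig
import Summits.HubbardSuperconductivity.HubbardSuperconductivity.Theorems.ChiralWindowCwKLChiralWindowBlockBounds
import Summits.HubbardSuperconductivity.HubbardSuperconductivity.Theorems.CwKLChiralWindow.Negative.ChannelStructure

/-!
# Crux `CwKLChiralWindow` (stmt-1741), line `Sketch`: point-group symmetries of the certificate's trigonometric polynomials

The `E_x`-block form of the checker (`Theorems/ChiralWindowDefsEx.lean`) runs the Temple certificate of the doublet channel on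
the reflection-even half of the `E` sector; its abstract bound `stub_klChannelBoundX` asks for two symmetry facts about the
record's trigonometric polynomials (`KLTrig`, `Theorems/ChiralWindowDefs.lean`), proved here:

* `kl_bkbx_toFun_rot1` (registered) — the exact rational quarter turn `KLTrig.rot1` of a trigonometric polynomial is its
  composition with the quarter turn of momentum space: `(rot1 t).toFun k = t.toFun (rot k)` (`arg (rot k) ≡ arg k + π/2`,
  the addition formulas, and `cos (jπ/2) = cosQuarter j`, `sin (jπ/2) = sinQuarter j` by `j mod 4`);
* `kl_bkbx_toFun_refl_of_cosOnly`, `kl_bkbx_trialFun_refl` — a cosine-only polynomial (`KLTrig.cosOnly`) is EVEN under the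
  axis reflection `(k₀, k₁) ↦ (k₀, -k₁)` (`arg (refl k) ≡ -arg k`);
* `kl_bkbx_deflList_rot`, `kl_bkbx_deflKernel_rot` — a deflation list made of consecutive quarter-turn pairs
  `(c, u), (c, u ∘ rot)` of ODD (`E`-channel) vectors (`KLBlock.deflPairsOK`, `KLBlock.deflOK … E`) has a quarter-turn
  invariant kernel `Σ c u(k) u(k')`: `u(rot² k) = u(-k) = -u(k)` (`rot_rot`, `inChannel_E_iff_odd`), so each pair
  contributes `u⊗u + (u∘rot)⊗(u∘rot)` on both sides.
-/

noncomputable section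

set_option linter.dupNamespace false

namespace Summit.HubbardSuperconductivity.HubbardSuperconductivity.Theorems

open MeasureTheory Literature.MathematicalPhysics.QuantumLattice CwKLChiralWindow

/-! ### The quarter values `cos (jπ/2)`, `sin (jπ/2)` -/

/-- `j · (π/2) ≡ π/2 (mod 2π)` for `j ≡ 1 (4)`. [folklore] -/
theorem kl_bkbx_nsmul_pi_div_two_of_mod_one {j : ℕ} (hj : j % 4 = 1) :
    j • ((Real.pi / 2 : ℝ) : Real.Angle) = ((Real.pi / 2 : ℝ) : Real.Angle) := by
  obtain ⟨m, rfl⟩ : ∃ m, j = 4 * m + 1 := ⟨j / 4, by omega⟩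
  rw [← Real.Angle.natCast_mul_eq_nsmul, Real.Angle.angle_eq_iff_two_pi_dvd_sub]
  exact ⟨m, by push_cast; ring⟩

/-- `j · (π/2) ≡ -π/2 (mod 2π)` for `j ≡ 3 (4)`. [folklore] -/
theorem kl_bkbx_nsmul_pi_div_two_of_mod_three {j : ℕ} (hj : j % 4 = 3) :
    j • ((Real.pi / 2 : ℝ) : Real.Angle) = ((-(Real.pi / 2) : ℝ) : Real.Angle) := by
  obtain ⟨m, rfl⟩ : ∃ m, j = 4 * m + 3 := ⟨j / 4, by omega⟩
  rw [← Real.Angle.natCast_mul_eq_nsmul, Real.Angle.angle_eq_iff_two_pi_dvd_sub]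
  exact ⟨m + 1, by push_cast; ring⟩

/-- `cos (jπ/2)` is the rational `KLTrig.cosQuarter j ∈ {1, 0, -1, 0}`. [folklore] -/
theorem kl_bkbx_cosQuarter_eq (j : ℕ) :
    Real.Angle.cos (j • ((Real.pi / 2 : ℝ) : Real.Angle)) = ((KLTrig.cosQuarter j : ℚ) : ℝ) := by
  unfold KLTrig.cosQuarter
  have h4 : j % 4 = 0 ∨ j % 4 = 1 ∨ j % 4 = 2 ∨ j % 4 = 3 := by omega
  rcases h4 with h | h | h | h
  · rw [kl_hc_nsmul_pi_div_two_of_mod_zero h, Real.Angle.cos_zero]; simp [h]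
  · rw [kl_bkbx_nsmul_pi_div_two_of_mod_one h, Real.Angle.cos_coe, Real.cos_pi_div_two]; simp [h]
  · rw [kl_hc_nsmul_pi_div_two_of_mod_two h, Real.Angle.cos_coe_pi]; simp [h]
  · rw [kl_bkbx_nsmul_pi_div_two_of_mod_three h, Real.Angle.cos_coe, Real.cos_neg, Real.cos_pi_div_two]; simp [h]

/-- `sin (jπ/2)` is the rational `KLTrig.sinQuarter j ∈ {0, 1, 0, -1}`. [folklore] -/
theorem kl_bkbx_sinQuarter_eq (j : ℕ) :
    Real.Angle.sin (j • ((Real.pi / 2 : ℝ) : Real.Angle)) = ((KLTrig.sinQuarter j : ℚ) : ℝ) := by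
  unfold KLTrig.sinQuarter
  have h4 : j % 4 = 0 ∨ j % 4 = 1 ∨ j % 4 = 2 ∨ j % 4 = 3 := by omega
  rcases h4 with h | h | h | h
  · rw [kl_hc_nsmul_pi_div_two_of_mod_zero h, Real.Angle.sin_zero]; simp [h]
  · rw [kl_bkbx_nsmul_pi_div_two_of_mod_one h, Real.Angle.sin_coe, Real.sin_pi_div_two]; simp [h]
  · rw [kl_hc_nsmul_pi_div_two_of_mod_two h, Real.Angle.sin_coe_pi]; simp [h]
  · rw [kl_bkbx_nsmul_pi_div_two_of_mod_three h, Real.Angle.sin_coe, Real.sin_neg, Real.sin_pi_div_two]; simp [h]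

/-! ### The addition formulas for a quarter shift of the angle -/

/-- `cos (j θ') = cos(jπ/2) cos (j θ) - sin(jπ/2) sin (j θ)` whenever `θ' ≡ θ + π/2 (mod 2π)`. [folklore] -/
theorem kl_bkbx_cos_shift {θ θ' : ℝ}
    (hθ : (θ' : Real.Angle) = (θ : Real.Angle) + ((Real.pi / 2 : ℝ) : Real.Angle)) (j : ℕ) :
    Real.cos (j * θ') =
      ((KLTrig.cosQuarter j : ℚ) : ℝ) * Real.cos (j * θ) - ((KLTrig.sinQuarter j : ℚ) : ℝ) * Real.sin (j * θ) := by
  rw [kl_hc_cos_nat_mul, hθ, nsmul_add, Real.Angle.cos_add, kl_bkbx_cosQuarter_eq, kl_bkbx_sinQuarter_eq,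
    ← kl_hc_cos_nat_mul, ← kl_hc_sin_nat_mul]
  ring

/-- `sin (j θ') = cos(jπ/2) sin (j θ) + sin(jπ/2) cos (j θ)` whenever `θ' ≡ θ + π/2 (mod 2π)`. [folklore] -/
theorem kl_bkbx_sin_shift {θ θ' : ℝ}
    (hθ : (θ' : Real.Angle) = (θ : Real.Angle) + ((Real.pi / 2 : ℝ) : Real.Angle)) (j : ℕ) :
    Real.sin (j * θ') =
      ((KLTrig.cosQuarter j : ℚ) : ℝ) * Real.sin (j * θ) + ((KLTrig.sinQuarter j : ℚ) : ℝ) * Real.cos (j * θ) := by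
  rw [kl_hc_sin_nat_mul, hθ, nsmul_add, Real.Angle.sin_add, kl_bkbx_cosQuarter_eq, kl_bkbx_sinQuarter_eq,
    ← kl_hc_cos_nat_mul, ← kl_hc_sin_nat_mul]
  ring

/-! ### The quarter turn of a trigonometric polynomial -/

/-- Peeling one cosine and one sine term off `KLTrig.eval`. [folklore] -/
theorem kl_bkbx_eval_cons_cons (a c : ℕ × ℚ) (t : KLTrig) (θ : ℝ) :
    KLTrig.eval ⟨a :: t.cosC, c :: t.sinC⟩ θ =
      (a.2 : ℝ) * Real.cos (a.1 * θ) + (c.2 : ℝ) * Real.sin (c.1 * θ) + t.eval θ := by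
  simp only [KLTrig.eval, List.map_cons, List.sum_cons]
  ring

/-- Peeling one cosine term off `KLTrig.eval`. [folklore] -/
theorem kl_bkbx_eval_cons_cos (p : ℕ × ℚ) (Lc Ls : List (ℕ × ℚ)) (θ : ℝ) :
    KLTrig.eval ⟨p :: Lc, Ls⟩ θ = (p.2 : ℝ) * Real.cos (p.1 * θ) + KLTrig.eval ⟨Lc, Ls⟩ θ := by
  simp only [KLTrig.eval, List.map_cons, List.sum_cons]
  ring

/-- Peeling one sine term off `KLTrig.eval`. [folklore] -/
theorem kl_bkbx_eval_cons_sin (p : ℕ × ℚ) (Lc Ls : List (ℕ × ℚ)) (θ : ℝ) :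
    KLTrig.eval ⟨Lc, p :: Ls⟩ θ = (p.2 : ℝ) * Real.sin (p.1 * θ) + KLTrig.eval ⟨Lc, Ls⟩ θ := by
  simp only [KLTrig.eval, List.map_cons, List.sum_cons]
  ring

/-- **The quarter turn on angles**: `(rot1 ⟨Lc, Ls⟩)(θ) = ⟨Lc, Ls⟩(θ')` for `θ' ≡ θ + π/2 (mod 2π)` (induction over the two
coefficient lists with the addition formulas). [folklore] -/
theorem kl_bkbx_eval_rot1 {θ θ' : ℝ}
    (hθ : (θ' : Real.Angle) = (θ : Real.Angle) + ((Real.pi / 2 : ℝ) : Real.Angle)) :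
    ∀ Lc Ls : List (ℕ × ℚ), (KLTrig.rot1 ⟨Lc, Ls⟩).eval θ = KLTrig.eval ⟨Lc, Ls⟩ θ' := by
  intro Lc Ls
  induction Lc with
  | nil =>
    induction Ls with
    | nil => simp [KLTrig.eval, KLTrig.rot1]
    | cons p Ls ih =>
      have h1 : KLTrig.rot1 ⟨[], p :: Ls⟩ = ⟨(p.1, p.2 * KLTrig.sinQuarter p.1) :: (KLTrig.rot1 ⟨[], Ls⟩).cosC,
          (p.1, p.2 * KLTrig.cosQuarter p.1) :: (KLTrig.rot1 ⟨[], Ls⟩).sinC⟩ := rfl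
      rw [h1, kl_bkbx_eval_cons_cons, ih, kl_bkbx_eval_cons_sin, kl_bkbx_sin_shift hθ]
      push_cast
      ring
  | cons p Lc ih =>
    have h1 : KLTrig.rot1 ⟨p :: Lc, Ls⟩ = ⟨(p.1, p.2 * KLTrig.cosQuarter p.1) :: (KLTrig.rot1 ⟨Lc, Ls⟩).cosC,
        (p.1, -(p.2 * KLTrig.sinQuarter p.1)) :: (KLTrig.rot1 ⟨Lc, Ls⟩).sinC⟩ := rfl
    rw [h1, kl_bkbx_eval_cons_cons, ih, kl_bkbx_eval_cons_cos, kl_bkbx_cos_shift hθ]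
    push_cast
    ring

/-- **The quarter turn of a trigonometric polynomial** (`kl_bkbx_toFun_rot1`, registered): the exact rational rewriting
`KLTrig.rot1` of `θ ↦ t(θ + π/2)` is the composition of `t.toFun` with the quarter turn of momentum space,
`(rot1 t).toFun k = t.toFun (rot k)` (`arg (rot k) ≡ arg k + π/2`; both sides vanish at the origin). [folklore] -/
theorem kl_bkbx_toFun_rot1 : ∀ (t : KLTrig) (k : Momentum), t.rot1.toFun k = t.toFun (rotMomentum k) := by
  intro t k
  by_cases hk : k = 0
  · subst hk
    rw [kl_hc_rot_zero, klTrig_toFun_zero, klTrig_toFun_zero]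
  · obtain ⟨Lc, Ls⟩ := t
    unfold KLTrig.toFun
    rw [if_neg hk, if_neg (rotMomentum_ne_zero hk)]
    exact kl_bkbx_eval_rot1 (kl_hc_arg_rot hk) Lc Ls

/-! ### Reflection-evenness of cosine-only polynomials -/

/-- **A cosine-only trigonometric polynomial is even under the axis reflection** `(k₀, k₁) ↦ (k₀, -k₁)`
(`arg (refl k) ≡ -arg k`, cosines are even). [folklore] -/
theorem kl_bkbx_toFun_refl_of_cosOnly (t : KLTrig) (h : t.cosOnly = true) (k : Momentum) :
    t.toFun (reflMomentum k) = t.toFun k := by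
  have hs : t.sinC = [] := by simpa [KLTrig.cosOnly, List.isEmpty_iff] using h
  by_cases hk : k = 0
  · subst hk
    rw [kl_hc_refl_zero]
  · have hcos : ∀ j : ℕ, Real.cos (j * Complex.arg ⟨reflMomentum k 0, reflMomentum k 1⟩) =
        Real.cos (j * Complex.arg ⟨k 0, k 1⟩) := by
      intro j
      have h1 := kl_hc_cos_refl j k
      rwa [if_neg (reflMomentum_ne_zero hk), if_neg hk] at h1
    unfold KLTrig.toFun KLTrig.eval
    rw [if_neg (reflMomentum_ne_zero hk), if_neg hk, hs]
    simp only [List.map_nil, List.sum_nil, add_zero, hcos]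

/-- **A cosine-only trial is reflection-even** (block form, the hypothesis `Φ ∘ refl = Φ` of `stub_klChannelBoundX`).
[folklore] -/
theorem kl_bkbx_trialFun_refl (b : KLBlock) (tab : List KLTrig) (h : (klTab tab b.trial).cosOnly = true)
    (k : Momentum) : b.trialFun tab (reflMomentum k) = b.trialFun tab k :=
  kl_bkbx_toFun_refl_of_cosOnly _ h k

/-! ### Quarter-turn invariance of a paired deflation kernel -/

/-- `KLTrig.beqB` decides equality of trigonometric polynomials. [folklore] -/
theorem kl_bkbx_eq_of_beqB {t₁ t₂ : KLTrig} (h : t₁.beqB t₂ = true) : t₁ = t₂ := by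
  obtain ⟨a₁, b₁⟩ := t₁
  obtain ⟨a₂, b₂⟩ := t₂
  simp only [KLTrig.beqB, Bool.and_eq_true, decide_eq_true_eq] at h
  obtain ⟨rfl, rfl⟩ := h
  rfl

/-- **Quarter-turn invariance of a paired deflation list**: if the list consists of consecutive pairs `(c, i), (c, i')`
with `tab[i'] = rot1 tab[i]` (`KLBlock.deflPairsList`) and every vector fits `E` (is odd), then
`Σ c u(rot k) u(rot k') = Σ c u(k) u(k')`: with `u' = u ∘ rot`, `u'(rot k) = u(-k) = -u(k)`. [folklore] -/
theorem kl_bkbx_deflList_rot (tab : List KLTrig) (k k' : Momentum) : ∀ L : List (ℚ × ℕ),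
    KLBlock.deflPairsList tab L = true → (∀ d ∈ L, (klTab tab d.2).fits D4Irrep.E = true) →
    (L.map fun d : ℚ × ℕ => (d.1 : ℝ) *
        ((klTab tab d.2).toFun (rotMomentum k) * (klTab tab d.2).toFun (rotMomentum k'))).sum =
      (L.map fun d : ℚ × ℕ => (d.1 : ℝ) * ((klTab tab d.2).toFun k * (klTab tab d.2).toFun k')).sum
  | [], _, _ => by simp
  | [_], h, _ => by simp [KLBlock.deflPairsList] at h
  | d :: d' :: rest, h, hf => by
    simp only [KLBlock.deflPairsList, Bool.and_eq_true, decide_eq_true_eq] at h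
    obtain ⟨⟨hc, hb⟩, hrest⟩ := h
    have ih := kl_bkbx_deflList_rot tab k k' rest hrest
      fun e he => hf e (List.mem_cons_of_mem _ (List.mem_cons_of_mem _ he))
    have heq : klTab tab d'.2 = (klTab tab d.2).rot1 := kl_bkbx_eq_of_beqB hb
    have hodd : ∀ q, (klTab tab d.2).toFun (-q) = -(klTab tab d.2).toFun q :=
      (inChannel_E_iff_odd _).1 (stub_klTrigChannel _ _ (hf d List.mem_cons_self))
    simp only [List.map_cons, List.sum_cons]
    rw [ih, heq, hc]
    simp only [kl_bkbx_toFun_rot1, CwKLChiralWindow.Negative.rot_rot, hodd]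
    ring

/-- Admissible deflation: every vector fits the channel. [folklore] -/
theorem kl_bkbx_defl_fits {b : KLBlock} {tab : List KLTrig} {χ : D4Irrep} (h : b.deflOK tab χ = true) :
    ∀ d ∈ b.defl, (klTab tab d.2).fits χ = true := by
  simp only [KLBlock.deflOK, List.all_eq_true, Bool.and_eq_true, decide_eq_true_eq] at h
  exact fun d hd => (h d hd).2

/-- **Quarter-turn invariance of the block's deflation kernel** (the hypothesis
`Σ c u(rot k) u(rot k') = Σ c u(k) u(k')` of `stub_klChannelBoundX`, `Fin`-indexed as in `kl_bkb_deflKernel_eq`): from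
`deflPairsOK` and `deflOK … E`. [folklore] -/
theorem kl_bkbx_deflKernel_rot (b : KLBlock) (tab : List KLTrig) (hP : b.deflPairsOK tab = true)
    (hD : b.deflOK tab D4Irrep.E = true) (k k' : Momentum) :
    ∑ m : Fin b.defl.length, ((b.defl[(m : ℕ)].1 : ℚ) : ℝ) *
        ((klTab tab b.defl[(m : ℕ)].2).toFun (rotMomentum k) * (klTab tab b.defl[(m : ℕ)].2).toFun (rotMomentum k')) =
      ∑ m : Fin b.defl.length, ((b.defl[(m : ℕ)].1 : ℚ) : ℝ) *
        ((klTab tab b.defl[(m : ℕ)].2).toFun k * (klTab tab b.defl[(m : ℕ)].2).toFun k') := by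
  rw [← kl_bkb_deflKernel_eq b tab (rotMomentum k) (rotMomentum k'), ← kl_bkb_deflKernel_eq b tab k k']
  exact kl_bkbx_deflList_rot tab k k' b.defl hP (kl_bkbx_defl_fits hD)

end Summit.HubbardSuperconductivity.HubbardSuperconductivity.Theorems

end
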